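import Mathlib
import Summits.Ventures.PercRepro2.Defs
import Summits.Ventures.PercRepro2.Graph
import Summits.Ventures.PercRepro2.Harris
import Summits.Ventures.PercRepro2.RowC1Cross
import Summits.Ventures.PercRepro2.RowC1CrossRootB
import Summits.Ventures.PercRepro2.RowC1CrossIdentity

/-!
# The cross term of row 2′C1 at an `a₂o`-edge is nonnegative modulo the rows of the two pins
(blind cell PercRepro2, p2 g34; proofs/P2-G34-ROOT.md §6)

At an edge `e = a₂o` (the root `a₂` joined to the mark `o`) opening `e` puts `o ∈ H` surely, so
`P¹(Q, o ∈ U) = P¹(Q)` (`prob_update_one_oUQ_eq_Q`) and the `oU`-shift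
`P⁰(Q)·P¹(Q, oU) − P¹(Q)·P⁰(Q, oU) = P¹(Q)·(P⁰(Q) − P⁰(Q, oU)) ≥ 0`; the `bH`-shift at an
`a₂`-edge is `≥ 0` (`bHQ_pin_open_mul_ge`, the cell's `CCT.shift_root_edge`).  By the cross-term
identity (`c1Cross_nonneg_of_a₂_edge`) the cross term is then nonnegative as soon as the rows of
`p[e↦0]` and `p[e↦1]` are — the first edge TYPE at which `CrossNonneg` holds unconditionally
modulo the induction hypothesis of `c1Slack_nonneg_of_cross` (kit j334695: the sign product is
`≥ 0` on 89,197 / 89,197 `a₂o`-edges, the only type with no failure).  Std axioms.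
-/

namespace Summit.Ventures.PercRepro2

namespace RowC1

section A2O

variable {V : Type*} {E : Type*} [Fintype E] [DecidableEq E] [Fintype V] [DecidableEq V]
  {R : Type*} [Field R] [LinearOrder R] [IsStrictOrderedRing R]

omit [Fintype E] [DecidableEq E] [Fintype V] [DecidableEq V] [Field R] [LinearOrder R]
  [IsStrictOrderedRing R] in
/-- With the edge `e = a₂o` open, `o ↔ a₂`, hence `o ∈ U`: `Q ∩ openEdge e ⊆ oU ∩ Q`. -/
lemma Q_inter_openEdge_subset_oUQ (ends : E → Sym2 V) {e : E} {a₂ o : V}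
    (hends : ends e = s(a₂, o)) (a₁ : V) :
    (connEvent ends a₁ a₂)ᶜ ∩ openEdge e ⊆
      (connEvent ends a₁ o ∪ connEvent ends a₂ o) ∩ (connEvent ends a₁ a₂)ᶜ := by
  rintro ω ⟨hQ, he⟩
  refine ⟨Or.inr ?_, hQ⟩
  exact conn_of_openAdj ⟨e, he, hends⟩

omit [Fintype V] [DecidableEq V] in
/-- Under `p[e↦1]` with `e = a₂o`, the event `o ∈ U` is sure on `Q`: `P¹(Q, oU) = P¹(Q)`. -/
lemma prob_update_one_oUQ_eq_Q (p : E → R) (hp : IsProbVec p) (ends : E → Sym2 V) {e : E}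
    {a₂ o : V} (hends : ends e = s(a₂, o)) (a₁ : V) :
    prob (Function.update p e (1 : R))
        ((connEvent ends a₁ o ∪ connEvent ends a₂ o) ∩ (connEvent ends a₁ a₂)ᶜ) =
      prob (Function.update p e (1 : R)) (connEvent ends a₁ a₂)ᶜ := by
  have hp' := hp.update e zero_le_one le_rfl
  refine le_antisymm (prob_mono hp' Set.inter_subset_right) ?_
  calc prob (Function.update p e (1 : R)) (connEvent ends a₁ a₂)ᶜ
      = prob (Function.update p e (1 : R)) ((connEvent ends a₁ a₂)ᶜ ∩ openEdge e) :=
        (prob_update_one_inter_openEdge p _ e).symm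
    _ ≤ prob (Function.update p e (1 : R))
          ((connEvent ends a₁ o ∪ connEvent ends a₂ o) ∩ (connEvent ends a₁ a₂)ᶜ) :=
        prob_mono hp' (Q_inter_openEdge_subset_oUQ ends hends a₁)

/-- **The cross term at an `a₂o`-edge is nonnegative modulo the rows of the two pins.** -/
theorem c1Cross_nonneg_of_a₂o_edge (p : E → R) (hp : IsProbVec p) (ends : E → Sym2 V) {e : E}
    {a₂ o : V} (hends : ends e = s(a₂, o)) (a₁ b : V)
    (h0 : 0 ≤ c1Slack (Function.update p e (0 : R)) ends a₁ a₂ o b)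
    (h1 : 0 ≤ c1Slack (Function.update p e (1 : R)) ends a₁ a₂ o b) :
    0 ≤ c1Cross p ends a₁ a₂ o b e := by
  apply c1Cross_nonneg_of_a₂_edge p hp ends hends a₁ o b h0 h1
  rw [prob_update_one_oUQ_eq_Q p hp ends hends a₁]
  have hA1 : 0 ≤ prob (Function.update p e (1 : R)) (connEvent ends a₁ a₂)ᶜ :=
    prob_nonneg (hp.update e zero_le_one le_rfl) _
  have hD0 : prob (Function.update p e (0 : R))
      ((connEvent ends a₁ o ∪ connEvent ends a₂ o) ∩ (connEvent ends a₁ a₂)ᶜ) ≤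
      prob (Function.update p e (0 : R)) (connEvent ends a₁ a₂)ᶜ :=
    prob_mono (hp.update e le_rfl zero_le_one) Set.inter_subset_right
  calc prob (Function.update p e (1 : R)) (connEvent ends a₁ a₂)ᶜ *
        prob (Function.update p e (0 : R))
          ((connEvent ends a₁ o ∪ connEvent ends a₂ o) ∩ (connEvent ends a₁ a₂)ᶜ)
      ≤ prob (Function.update p e (1 : R)) (connEvent ends a₁ a₂)ᶜ *
          prob (Function.update p e (0 : R)) (connEvent ends a₁ a₂)ᶜ :=
        mul_le_mul_of_nonneg_left hD0 hA1
    _ = prob (Function.update p e (0 : R)) (connEvent ends a₁ a₂)ᶜ *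
          prob (Function.update p e (1 : R)) (connEvent ends a₁ a₂)ᶜ := mul_comm _ _

end A2O

end RowC1

end Summit.Ventures.PercRepro2
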